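import Literature.Computability.AlgebraicComplexity.PointSegmentBricks
import Literature.Computability.QuantumComplexity.FactoringPrimesProofs
import HarnessLib

/-!
# Bläser–Ikenmeyer–Jindal–Lysikov 2018, Thm. 6 — the `FP` verifier of the `∃·coRP` protocol for the
# graph of the `0/1` permanent (guessed prime, guessed circuits mod `p`, Kabanets–Impagliazzo chain)

File 4 of the route to `BIJL2018_thm6` (`HasVP0NaturalProofsAgainstPerZero → P^{#P} ⊆ ∃·BPP`,
`BIJL18PermanentZero.lean`). The printed proof (ECCC TR18-064, p.19) lets an `∃BPP` machine guess a
`VP⁰` circuit vanishing on `{per = 0}` and RUN Kaltofen's factoring algorithm over `𝔽_p` to obtain a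
circuit for the permanent. The route of the tree guesses instead of computing: over `𝔽_p` the factor
`per_k` has a small circuit with constants of `log p` bits (`BIJL2018_thm24`, proved in the tree), so
the witness is

  `u = ⟨bin p, encList [w_0, …, w_n]⟩`  (a prime `p` and integer circuit codes `w_i`, read
  junk-tolerantly by `CircuitCode.rdCircuit |w_i| w_i`, constants reduced mod `p`),

and the verifier checks, modulo `p` and at ONE random matrix `R ∈ [0, 2^b)^{n×n}` (`b = n² + 2`,
`n²·b` coins), Kabanets–Impagliazzo's row-expansion chain (STOC 2003, Lemma 11) in the fixed layout of
`PermanentLaplaceChain.lean`: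

* `C1` the instance `z = ⟨⟨A⟩, bin v⟩` is canonical (`KIReduction.validF`); `C2` `p` is prime (AKS,
  `AKSMachine.aksFn`); `C3` `v < p`; `C4` `2^b ≤ p` (as `b < |bin p|`);
* `lvl0`: `formalDegree (rd w_0) ≤ 1` and `w_0(R) ≡ 1`;
* level `i + 1 ≤ n`: `formalDegree (rd w_{i+1}) ≤ i + 1` (`CircuitCode.fdegLeF`) and
  `w_{i+1}(R) ≡ Σ_{j ≤ i} R_{0j} · w_i(minor_j R) (mod p)` — every value an `evalAtF` evaluation of a
  code at an explicit point segment (`PointSeg.fitSegF`, `PointSeg.minorSegF`), the sum a counted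
  `addFn` fold; the verifier COUNTS the failing levels (`levelsSumF`) and asks for `0`;
* `final`: `w_n(A) ≡ v (mod p)` at the entry segment `PointSeg.entrySegF` of the parsed `0/1` matrix.

This file is the machine: `Thm6Verifier.verifF ∈ FP` (`verifF_mem_FP`), one-bit (`verifF_oneBit`), and
its TOTAL structural specification `verifF_eq_true_iff` (on `⟨x, y⟩`: the conjunction above, the
evaluations left as `evalAtF` terms), plus the value lemmas `innerSumF_apply` (the level sum) and
`bitsToNat_evalWord` (an `evalAtF` term is `(semPoly w)(pt) mod p`). The probability analysis
(`L' ∈ coRP`), the graph presentation and the assembly of Thm. 6 are in `BIJL18Thm6Holds.lean`.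
HONEST FRAMING: the verifier of a published CONDITIONAL barrier theorem; `VP ≠ VNP` is NOT proved.

## References

* M. Bläser, C. Ikenmeyer, G. Jindal, V. Lysikov, *Generalized matrix completion and algebraic
  natural proofs*, STOC 2018 = ECCC TR18-064, Thm. 6 and §6 (proof, p.19) [BlaserIkenmeyerJindalLysikov2018].
* V. Kabanets, R. Impagliazzo, STOC 2003, Lemma 11 and proof of Cor. 12 (p. 358) [KabanetsImpagliazzo2003].
* M. Agrawal, N. Kayal, N. Saxena, Ann. of Math. 160 (2004), Thm 4.1 [AgrawalKayalSaxena2004].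
* S. Arora, B. Barak, CUP 2009, §1.3, Lemma 7.5, §7.2.3 [AroraBarakCC2009].
-/

noncomputable section

namespace Literature.Barriers.ValiantsHypothesis

namespace Thm6Verifier

open Literature.Computability.Complexity Literature.Computability.AlgebraicComplexity
open Literature.Computability.QuantumComplexity
open _root_.Computability Brick HashBricks Plumb PRelSigma PRelSigPi ModularZeroTest PointSeg CircuitCode
open Polynomial

/-! ### Small helpers -/

/-- `onesFn w = 1^{|w|}`. [folklore] -/
private theorem onesFn_eq_ones (w : List Bool) : onesFn w = ones w.length := by
  simp [onesFn, ones, unaryEncodeNat_eq_replicate]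

/-- Item `i` of a nested-pair list by iterated second projections. [folklore] -/
private theorem fstF_iterate_sndF_encList (L : List (List Bool)) (i : ℕ) :
    fstF (sndF^[i] (encList L)) = L.getD i [] := by
  rw [← KIReduction.getD_readList, KIReduction.readList_encList]

/-- A canonical numeral of a value `< p` is no longer than `bin p`. [folklore] -/
private theorem length_encodeNat_le_of_lt {m p : ℕ} (h : m < p) :
    (encodeNat m).length ≤ (encodeNat p).length := by
  rw [TM2Pass.length_encodeNat_eq_size, TM2Pass.length_encodeNat_eq_size]
  exact Nat.size_le_size h.le

/-! ### Accessors of the input `s = ⟨x, y⟩`, `x = ⟨z, ⟨bin p, W⟩⟩` -/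

/-- `1ⁿ`, `n = KIReduction.nOf x` (the unary dimension field, re-written as ones). [folklore] -/
def nU : List Bool → List Bool := onesFn ∘ KIReduction.uF ∘ fstF
/-- `1^b`, `b = n² + 2` (block length of one matrix entry of the random point). [cite: BlaserIkenmeyerJindalLysikov2018, §6 (proof of Thm. 5, step 7)] -/
def bU : List Bool → List Bool := polyFn (X ^ 2 + Polynomial.C 2) ∘ nU
/-- `bin p`, the canonical numeral of the guessed prime (first field of the witness). [cite: BlaserIkenmeyerJindalLysikov2018, §6 (proof of Thm. 5, step 4)] -/
def pcF : List Bool → List Bool := addFn ∘ fanoutFn (fstF ∘ sndF ∘ fstF) (fun _ => [])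
/-- `W`, the list of guessed circuit codes (second field of the witness). [cite: BlaserIkenmeyerJindalLysikov2018, §6 (proof of Thm. 5, step 1)] -/
def WF : List Bool → List Bool := sndF ∘ sndF ∘ fstF
/-- `bin v`, the value field of the instance. [folklore] -/
def vcF' : List Bool → List Bool := KIReduction.vcF ∘ fstF
/-- The rows field of the instance matrix. [folklore] -/
def rowsF' : List Bool → List Bool := KIReduction.rowsF ∘ fstF
/-- `T = y ↾ n²·b`, the coin blocks of the random matrix. [cite: BlaserIkenmeyerJindalLysikov2018, §6 (proof of Thm. 5, step 7)] -/
def TF : List Bool → List Bool := takeFn ∘ fanoutFn (umulFn ∘ fanoutFn (umulFn ∘ fanoutFn nU nU) bU) sndF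
/-- **The context record** `⟨1ⁿ, ⟨1^b, ⟨bin p, ⟨T, W⟩⟩⟩⟩` handed to the level folds. [folklore] -/
def ctxF : List Bool → List Bool := fanoutFn nU (fanoutFn bU (fanoutFn pcF (fanoutFn TF WF)))

/-- Plumbing: `nU ∈ FP`. [folklore] -/
private theorem nU_mem_FP : nU ∈ FP := comp_mem_FP onesFn_mem_FP (comp_mem_FP KIReduction.uF_mem_FP fstF_mem_FP)
/-- Plumbing: `bU ∈ FP`. [folklore] -/
private theorem bU_mem_FP : bU ∈ FP := comp_mem_FP (polyFn_mem_FP _) nU_mem_FP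
/-- Plumbing: `pcF ∈ FP`. [folklore] -/
private theorem pcF_mem_FP : pcF ∈ FP :=
  comp_mem_FP addFn_mem_FP (fanoutFn_mem_FP (comp_mem_FP fstF_mem_FP (comp_mem_FP sndF_mem_FP fstF_mem_FP)) (const_mem_FP _))
/-- Plumbing: `WF ∈ FP`. [folklore] -/
private theorem WF_mem_FP : WF ∈ FP := comp_mem_FP sndF_mem_FP (comp_mem_FP sndF_mem_FP fstF_mem_FP)
/-- Plumbing: `vcF' ∈ FP`. [folklore] -/
private theorem vcF'_mem_FP : vcF' ∈ FP := comp_mem_FP KIReduction.vcF_mem_FP fstF_mem_FP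
/-- Plumbing: `rowsF' ∈ FP`. [folklore] -/
private theorem rowsF'_mem_FP : rowsF' ∈ FP := comp_mem_FP KIReduction.rowsF_mem_FP fstF_mem_FP
/-- Plumbing: `TF ∈ FP`. [folklore] -/
private theorem TF_mem_FP : TF ∈ FP :=
  comp_mem_FP takeFn_mem_FP (fanoutFn_mem_FP (comp_mem_FP umulFn_mem_FP (fanoutFn_mem_FP
    (comp_mem_FP umulFn_mem_FP (fanoutFn_mem_FP nU_mem_FP nU_mem_FP)) bU_mem_FP)) sndF_mem_FP)
/-- Plumbing: `ctxF ∈ FP`. [folklore] -/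
private theorem ctxF_mem_FP : ctxF ∈ FP :=
  fanoutFn_mem_FP nU_mem_FP (fanoutFn_mem_FP bU_mem_FP (fanoutFn_mem_FP pcF_mem_FP (fanoutFn_mem_FP TF_mem_FP WF_mem_FP)))

/-- **The block length** `b(n) = n² + 2`. [cite: BlaserIkenmeyerJindalLysikov2018, §6 (proof of Thm. 5, step 7)] -/
def bOf (n : ℕ) : ℕ := n ^ 2 + 2

section Values

variable (z pb W y : List Bool)

/-- The input record. [folklore] -/
private def inp (z pb W y : List Bool) : List Bool := boolPair (boolPair z (boolPair pb W)) y

/-- Value of `nU`. [folklore] -/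
private theorem nU_inp : nU (inp z pb W y) = ones (KIReduction.nOf (boolPair z (boolPair pb W))) := by
  simp [nU, inp, onesFn_eq_ones, KIReduction.uF_apply, KIReduction.nOf]
/-- Value of `bU`. [folklore] -/
private theorem bU_inp : bU (inp z pb W y) = ones (bOf (KIReduction.nOf (boolPair z (boolPair pb W)))) := by
  simp [bU, nU_inp, bOf]
/-- Value of `pcF`. [folklore] -/
private theorem pcF_inp : pcF (inp z pb W y) = encodeNat (bitsToNat pb) := by
  simp [pcF, inp, addFn_boolPair]
/-- Value of `WF`. [folklore] -/
private theorem WF_inp : WF (inp z pb W y) = W := by simp [WF, inp]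
/-- Value of `vcF'`. [folklore] -/
private theorem vcF'_inp : vcF' (inp z pb W y) = KIReduction.vcStr (boolPair z (boolPair pb W)) := by
  simp [vcF', inp, KIReduction.vcF_apply]
/-- Value of `rowsF'`. [folklore] -/
private theorem rowsF'_inp : rowsF' (inp z pb W y) = KIReduction.rowsStr (boolPair z (boolPair pb W)) := by
  simp [rowsF', inp, KIReduction.rowsF_apply]
/-- Value of `TF`. [folklore] -/
private theorem TF_inp : TF (inp z pb W y) =
    y.take (KIReduction.nOf (boolPair z (boolPair pb W)) * KIReduction.nOf (boolPair z (boolPair pb W)) *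
      bOf (KIReduction.nOf (boolPair z (boolPair pb W)))) := by
  rw [TF, Function.comp_apply, fanoutFn_apply, takeFn_boolPair, Function.comp_apply, fanoutFn_apply, umulFn_apply,
    fstF_boolPair, sndF_boolPair, Function.comp_apply, fanoutFn_apply, umulFn_apply, fstF_boolPair, sndF_boolPair,
    nU_inp, bU_inp]
  simp only [KIReduction.length_ones']
  rw [inp, sndF_boolPair]
/-- Value of `ctxF`. [folklore] -/
private theorem ctxF_inp : ctxF (inp z pb W y) =
    boolPair (ones (KIReduction.nOf (boolPair z (boolPair pb W))))
      (boolPair (ones (bOf (KIReduction.nOf (boolPair z (boolPair pb W))))) (boolPair (encodeNat (bitsToNat pb))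
        (boolPair (y.take (KIReduction.nOf (boolPair z (boolPair pb W)) * KIReduction.nOf (boolPair z (boolPair pb W)) *
          bOf (KIReduction.nOf (boolPair z (boolPair pb W))))) W))) := by
  rw [ctxF, fanoutFn_apply, fanoutFn_apply, fanoutFn_apply, fanoutFn_apply, nU_inp, bU_inp, pcF_inp, TF_inp, WF_inp]

end Values

/-! ### One evaluation: the word, the point segment, the modulus -/

/-- **Evaluation brick**: from a word accessor `wf`, a segment brick `sg` (fed `⟨1^{|w|}, prm⟩` with the
parameter accessor `prm`), the modulus accessor `pc` and the block-length accessor `cb`, the term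
`evalAtF (mkCtx pc w (sg ⟨1^{|w|}, prm⟩) cb)`. [cite: BlaserIkenmeyerJindalLysikov2018, §6 (proof of Thm. 5, step 7: "evaluating at this point")] -/
def evalWordF (pc cb wf prm : List Bool → List Bool) (sg : List Bool → List Bool) : List Bool → List Bool :=
  evalAtF ∘ fanoutFn pc (fanoutFn wf (fanoutFn (sg ∘ fanoutFn (onesFn ∘ wf) prm) cb))

/-- `evalWordF … ∈ FP`. [cite: AroraBarakCC2009, §1.3] -/
theorem evalWordF_mem_FP {pc cb wf prm sg : List Bool → List Bool} (hpc : pc ∈ FP) (hcb : cb ∈ FP)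
    (hwf : wf ∈ FP) (hprm : prm ∈ FP) (hsg : sg ∈ FP) : evalWordF pc cb wf prm sg ∈ FP :=
  comp_mem_FP evalAtF_mem_FP (fanoutFn_mem_FP hpc (fanoutFn_mem_FP hwf (fanoutFn_mem_FP
    (comp_mem_FP hsg (fanoutFn_mem_FP (comp_mem_FP onesFn_mem_FP hwf) hprm)) hcb)))

/-- Value of the evaluation brick. [cite: AroraBarakCC2009, §1.3] -/
theorem evalWordF_apply (pc cb wf prm sg : List Bool → List Bool) (s : List Bool) :
    evalWordF pc cb wf prm sg s = evalAtF (mkCtx (pc s) (wf s) (sg (boolPair (ones (wf s).length) (prm s))) (cb s)) := by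
  simp [evalWordF, mkCtx, onesFn_eq_ones]

/-- **The value of an evaluation term**: for `p ≥ 2` and a segment of `|w|` blocks of `b` bits,
`⟦evalAtF (mkCtx (bin p) w seg 1^b)⟧ = ((semPoly w)(ptOf b |w| seg) mod p)` (as a natural number).
[cite: Schwartz1980, §3] -/
theorem bitsToNat_evalWord {p b : ℕ} (hp : 2 ≤ p) (w seg : List Bool) (hseg : seg.length = w.length * b) :
    bitsToNat (evalAtF (mkCtx (encodeNat p) w seg (ones b))) =
      ((MvPolynomial.eval (ptOf b (X.eval w.length) seg) (semPoly w)) % (p : ℤ)).toNat := by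
  rw [bitsToNat_evalAtF _ w seg b (by rwa [bitsToNat_encodeNat]) (by rwa [eval_X]), bitsToNat_encodeNat]

/-- **An evaluation term is a short numeral**: value `< p`, hence at most `|bin p|` symbols.
[cite: AroraBarakCC2009, §1.3] -/
theorem length_evalWord_le {p b : ℕ} (hp : 2 ≤ p) (w seg : List Bool) (hseg : seg.length = w.length * b) :
    (evalAtF (mkCtx (encodeNat p) w seg (ones b))).length ≤ (encodeNat p).length := by
  have hlt := bitsToNat_evalAtF_lt (encodeNat p) w seg b (by rwa [bitsToNat_encodeNat]) (by rwa [eval_X])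
  rw [bitsToNat_encodeNat] at hlt
  rw [evalAtF_spec _ w seg b (by rwa [bitsToNat_encodeNat]) (by rwa [eval_X]), numR]
  exact length_encodeNat_le_of_lt (by rwa [evalAtF_spec _ w seg b (by rwa [bitsToNat_encodeNat]) (by rwa [eval_X]),
    numR, bitsToNat_encodeNat] at hlt)

/-! ### The level record `ℓ = ⟨ctx, 1ⁱ⟩` and the inner record `⟨ℓ, 1ʲ⟩` -/

/-- `1ⁿ` of `ℓ`. [folklore] -/
def lcn : List Bool → List Bool := nthF 0 ∘ fstF
/-- `1^b` of `ℓ`. [folklore] -/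
def lcb : List Bool → List Bool := nthF 1 ∘ fstF
/-- `bin p` of `ℓ`. [folklore] -/
def lcp : List Bool → List Bool := nthF 2 ∘ fstF
/-- `T` of `ℓ`. [folklore] -/
def lcT : List Bool → List Bool := nthF 3 ∘ fstF
/-- `W` of `ℓ`. [folklore] -/
def lcW : List Bool → List Bool := sndPow 3 ∘ fstF
/-- `1ⁱ` of `ℓ`. [folklore] -/
def liU : List Bool → List Bool := sndF
/-- **The word `w_{i+1}`** of `ℓ`: item `i + 1` of `W`. [folklore] -/
def wNextF : List Bool → List Bool := nthItemFn ∘ fanoutFn (List.cons true ∘ liU) lcW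
/-- **`bin (i+1)`** of `ℓ` (the formal-degree cap of level `i + 1`). [folklore] -/
def capF : List Bool → List Bool := lenBinF ∘ List.cons true ∘ liU

/-- **Left-hand side of level `i+1`**: `w_{i+1}` evaluated at the fitted random matrix.
[cite: KabanetsImpagliazzo2003, Lemma 11 (2) (p. 358)] -/
def lhsF : List Bool → List Bool := evalWordF lcp lcb wNextF (fanoutFn lcb lcT) fitSegF

/-- `ctx` of the inner record `⟨ℓ, 1ʲ⟩`. [folklore] -/
def ictx : List Bool → List Bool := fstF ∘ fstF
/-- **The word `w_i`** of the inner record. [folklore] -/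
def iwCurF : List Bool → List Bool := nthItemFn ∘ fanoutFn (sndF ∘ fstF) (sndPow 3 ∘ ictx)
/-- **The minor evaluation** `w_i(minor_j R)` of the inner record.
[cite: KabanetsImpagliazzo2003, Lemma 11 (2) (p. 358)] -/
def minorEvF : List Bool → List Bool :=
  evalWordF (nthF 2 ∘ ictx) (nthF 1 ∘ ictx) iwCurF
    (fanoutFn (nthF 1 ∘ ictx) (fanoutFn (nthF 3 ∘ ictx) (fanoutFn (nthF 0 ∘ ictx) sndF))) minorSegF
/-- **The coefficient** `R_{0j} = ⟦block j of T⟧` of the inner record. [cite: KabanetsImpagliazzo2003, Lemma 11 (2) (p. 358)] -/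
def coefF : List Bool → List Bool := blockAtF ∘ fanoutFn (fanoutFn (nthF 1 ∘ ictx) (nthF 3 ∘ ictx)) sndF
/-- **The summand** `R_{0j} · w_i(minor_j R)` (as an integer numeral, not yet reduced). [cite: KabanetsImpagliazzo2003, Lemma 11 (2) (p. 358)] -/
def innerPiece : List Bool → List Bool := prodFn ∘ fanoutFn coefF minorEvF
/-- **The level sum** `Σ_{j ≤ i} R_{0j} · w_i(minor_j R)` on `ℓ` (counted `addFn` fold, `i + 1` rounds).
[cite: KabanetsImpagliazzo2003, Lemma 11 (2) (p. 358)] -/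
def innerSumF : List Bool → List Bool :=
  sndPow 2 ∘ foldLoop addFn (clipF 1 innerPiece) X ∘ fanoutFn id (fanoutFn capF (fanoutFn (fun _ => []) (fun _ => [])))
/-- **Right-hand side of level `i+1`**: the level sum reduced modulo `p`. [cite: KabanetsImpagliazzo2003, Lemma 11 (2) (p. 358)] -/
def rhsF : List Bool → List Bool := remFn ∘ fanoutFn innerSumF lcp
/-- **The formal-degree guard of level `i+1`**: `[formalDegree (rd w_{i+1}) ≤ i + 1]`.
[cite: BlaserIkenmeyerJindalLysikov2018, §6 (proof of Thm. 5, step 2)] -/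
def fdegNextF : List Bool → List Bool := fdegLeF ∘ fanoutFn wNextF capF
/-- **Level `i+1` passes**: degree guard and `lhs ≡ rhs`. [cite: KabanetsImpagliazzo2003, Lemma 11 (p. 358)] -/
def levelOKF : List Bool → List Bool := andFn fdegNextF (eqValFn ∘ fanoutFn lhsF rhsF)
/-- The failure bit of level `i+1`. [folklore] -/
def levelFailF : List Bool → List Bool := notFn levelOKF
/-- **The number of failing levels** `1 … n`, on the input `s` (counted `addFn` fold over `i < n` of the
failure bits, context `ctxF s`). [cite: KabanetsImpagliazzo2003, Lemma 11 (p. 358)] -/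
def levelsSumF : List Bool → List Bool :=
  sndPow 2 ∘ foldLoop addFn (clipF 1 levelFailF) X ∘
    fanoutFn ctxF (fanoutFn (lenBinF ∘ nU) (fanoutFn (fun _ => []) (fun _ => [])))
/-- **All levels pass**: the failure count is `0`. [cite: KabanetsImpagliazzo2003, Lemma 11 (p. 358)] -/
def allLevelsF : List Bool → List Bool := eqValFn ∘ fanoutFn levelsSumF (fun _ => [])

/-! ### Level `0`, the final evaluation, the four deterministic checks, the verifier -/

/-- `w_0 = fstF W`. [folklore] -/
def w0F : List Bool → List Bool := fstF ∘ WF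
/-- **`w_0` at the random matrix.** [cite: KabanetsImpagliazzo2003, Lemma 11 (1) (p. 358)] -/
def ev0F : List Bool → List Bool := evalWordF pcF bU w0F (fanoutFn bU TF) fitSegF
/-- **Level `0` passes**: `formalDegree (rd w_0) ≤ 1` and `w_0(R) ≡ 1`. [cite: KabanetsImpagliazzo2003, Lemma 11 (1) (p. 358)] -/
def lvl0F : List Bool → List Bool :=
  andFn (fdegLeF ∘ fanoutFn w0F (fun _ => [true])) (eqValFn ∘ fanoutFn ev0F (fun _ => [true]))
/-- `w_n`, item `n` of `W`. [folklore] -/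
def wnF : List Bool → List Bool := nthItemFn ∘ fanoutFn nU WF
/-- **`w_n` at the input matrix** (entry segment of the parsed `0/1` matrix).
[cite: KabanetsImpagliazzo2003, proof of Cor. 12 (p. 358)] -/
def evFinF : List Bool → List Bool := evalWordF pcF bU wnF (fanoutFn bU (fanoutFn rowsF' nU)) entrySegF
/-- **The final check** `w_n(A) ≡ v (mod p)`. [cite: KabanetsImpagliazzo2003, proof of Cor. 12 (p. 358)] -/
def finalF : List Bool → List Bool := eqValFn ∘ fanoutFn evFinF vcF'
/-- `C1`: the instance is a canonical graph-instance code. [cite: KabanetsImpagliazzo2003, §2.1 (p. 357)] -/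
def c1F : List Bool → List Bool := KIReduction.validF ∘ fstF
/-- `C2`: the guessed modulus is prime (AKS). [cite: AgrawalKayalSaxena2004, Thm 4.1] -/
def c2F : List Bool → List Bool := AKSMachine.aksFn ∘ pcF
/-- `C3`: `v < p`. [cite: BlaserIkenmeyerJindalLysikov2018, §6 (proof of Thm. 5, step 4: `p > n!`)] -/
def c3F : List Bool → List Bool := Brick.ltFn ∘ fanoutFn vcF' pcF
/-- `C4`: `2^b ≤ p`, tested as `b < |bin p|`. [cite: BlaserIkenmeyerJindalLysikov2018, §6 (proof of Thm. 5, step 4)] -/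
def c4F : List Bool → List Bool := ltLenF ∘ fanoutFn bU pcF
/-- **The verifier.** [cite: BlaserIkenmeyerJindalLysikov2018, Thm. 6 (proof, §6 p.19)] -/
def verifF : List Bool → List Bool :=
  andFn c1F (andFn c2F (andFn c3F (andFn c4F (andFn lvl0F (andFn allLevelsF finalF)))))

/-! ### Membership in `FP` -/

/-- Plumbing: `wNextF ∈ FP`. [folklore] -/
private theorem wNextF_mem_FP : wNextF ∈ FP :=
  comp_mem_FP nthItemFn_mem_FP (fanoutFn_mem_FP (comp_mem_FP (cons_mem_FP true) sndF_mem_FP)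
    (comp_mem_FP (sndPow_mem_FP 3) fstF_mem_FP))
/-- Plumbing: `capF ∈ FP`. [folklore] -/
private theorem capF_mem_FP : capF ∈ FP := comp_mem_FP lenBinF_mem_FP (comp_mem_FP (cons_mem_FP true) sndF_mem_FP)
/-- Plumbing: `lhsF ∈ FP`. [folklore] -/
private theorem lhsF_mem_FP : lhsF ∈ FP :=
  evalWordF_mem_FP (comp_mem_FP (nthF_mem_FP 2) fstF_mem_FP) (comp_mem_FP (nthF_mem_FP 1) fstF_mem_FP) wNextF_mem_FP
    (fanoutFn_mem_FP (comp_mem_FP (nthF_mem_FP 1) fstF_mem_FP) (comp_mem_FP (nthF_mem_FP 3) fstF_mem_FP)) fitSegF_mem_FP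
/-- Plumbing: `ictx ∈ FP`. [folklore] -/
private theorem ictx_mem_FP : ictx ∈ FP := comp_mem_FP fstF_mem_FP fstF_mem_FP
/-- Plumbing: `iwCurF ∈ FP`. [folklore] -/
private theorem iwCurF_mem_FP : iwCurF ∈ FP :=
  comp_mem_FP nthItemFn_mem_FP (fanoutFn_mem_FP (comp_mem_FP sndF_mem_FP fstF_mem_FP) (comp_mem_FP (sndPow_mem_FP 3) ictx_mem_FP))
/-- Plumbing: `minorEvF ∈ FP`. [folklore] -/
private theorem minorEvF_mem_FP : minorEvF ∈ FP :=
  evalWordF_mem_FP (comp_mem_FP (nthF_mem_FP 2) ictx_mem_FP) (comp_mem_FP (nthF_mem_FP 1) ictx_mem_FP) iwCurF_mem_FP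
    (fanoutFn_mem_FP (comp_mem_FP (nthF_mem_FP 1) ictx_mem_FP) (fanoutFn_mem_FP (comp_mem_FP (nthF_mem_FP 3) ictx_mem_FP)
      (fanoutFn_mem_FP (comp_mem_FP (nthF_mem_FP 0) ictx_mem_FP) sndF_mem_FP))) minorSegF_mem_FP
/-- Plumbing: `coefF ∈ FP`. [folklore] -/
private theorem coefF_mem_FP : coefF ∈ FP :=
  comp_mem_FP blockAtF_mem_FP (fanoutFn_mem_FP (fanoutFn_mem_FP (comp_mem_FP (nthF_mem_FP 1) ictx_mem_FP)
    (comp_mem_FP (nthF_mem_FP 3) ictx_mem_FP)) sndF_mem_FP)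
/-- Plumbing: `innerPiece ∈ FP`. [folklore] -/
private theorem innerPiece_mem_FP : innerPiece ∈ FP := comp_mem_FP prodFn_mem_FP (fanoutFn_mem_FP coefF_mem_FP minorEvF_mem_FP)
/-- Plumbing: `innerSumF ∈ FP`. [folklore] -/
private theorem innerSumF_mem_FP : innerSumF ∈ FP :=
  comp_mem_FP (sndPow_mem_FP 2) (comp_mem_FP (foldLoop_clipF_mem_FP 1 addFn_mem_FP length_addFn_le innerPiece_mem_FP X)
    (fanoutFn_mem_FP OracleCompose.id_mem_FP (fanoutFn_mem_FP capF_mem_FP (fanoutFn_mem_FP (const_mem_FP _) (const_mem_FP _)))))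
/-- Plumbing: `rhsF ∈ FP`. [folklore] -/
private theorem rhsF_mem_FP : rhsF ∈ FP :=
  comp_mem_FP remFn_mem_FP (fanoutFn_mem_FP innerSumF_mem_FP (comp_mem_FP (nthF_mem_FP 2) fstF_mem_FP))
/-- Plumbing: `fdegNextF ∈ FP`. [folklore] -/
private theorem fdegNextF_mem_FP : fdegNextF ∈ FP := comp_mem_FP fdegLeF_mem_FP (fanoutFn_mem_FP wNextF_mem_FP capF_mem_FP)
/-- Plumbing: `levelFailF ∈ FP`. [folklore] -/
private theorem levelFailF_mem_FP : levelFailF ∈ FP :=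
  notFn_mem_FP (andFn_mem_FP fdegNextF_mem_FP (comp_mem_FP eqValFn_mem_FP (fanoutFn_mem_FP lhsF_mem_FP rhsF_mem_FP)))
/-- Plumbing: `levelsSumF ∈ FP`. [folklore] -/
private theorem levelsSumF_mem_FP : levelsSumF ∈ FP :=
  comp_mem_FP (sndPow_mem_FP 2) (comp_mem_FP (foldLoop_clipF_mem_FP 1 addFn_mem_FP length_addFn_le levelFailF_mem_FP X)
    (fanoutFn_mem_FP ctxF_mem_FP (fanoutFn_mem_FP (comp_mem_FP lenBinF_mem_FP nU_mem_FP)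
      (fanoutFn_mem_FP (const_mem_FP _) (const_mem_FP _)))))
/-- Plumbing: `allLevelsF ∈ FP`. [folklore] -/
private theorem allLevelsF_mem_FP : allLevelsF ∈ FP :=
  comp_mem_FP eqValFn_mem_FP (fanoutFn_mem_FP levelsSumF_mem_FP (const_mem_FP _))
/-- Plumbing: `w0F ∈ FP`. [folklore] -/
private theorem w0F_mem_FP : w0F ∈ FP := comp_mem_FP fstF_mem_FP WF_mem_FP
/-- Plumbing: `lvl0F ∈ FP`. [folklore] -/
private theorem lvl0F_mem_FP : lvl0F ∈ FP :=
  andFn_mem_FP (comp_mem_FP fdegLeF_mem_FP (fanoutFn_mem_FP w0F_mem_FP (const_mem_FP _)))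
    (comp_mem_FP eqValFn_mem_FP (fanoutFn_mem_FP
      (evalWordF_mem_FP pcF_mem_FP bU_mem_FP w0F_mem_FP (fanoutFn_mem_FP bU_mem_FP TF_mem_FP) fitSegF_mem_FP) (const_mem_FP _)))
/-- Plumbing: `wnF ∈ FP`. [folklore] -/
private theorem wnF_mem_FP : wnF ∈ FP := comp_mem_FP nthItemFn_mem_FP (fanoutFn_mem_FP nU_mem_FP WF_mem_FP)
/-- Plumbing: `finalF ∈ FP`. [folklore] -/
private theorem finalF_mem_FP : finalF ∈ FP :=
  comp_mem_FP eqValFn_mem_FP (fanoutFn_mem_FP (evalWordF_mem_FP pcF_mem_FP bU_mem_FP wnF_mem_FP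
    (fanoutFn_mem_FP bU_mem_FP (fanoutFn_mem_FP rowsF'_mem_FP nU_mem_FP)) entrySegF_mem_FP) vcF'_mem_FP)

/-- **The verifier runs in polynomial time.** [cite: BlaserIkenmeyerJindalLysikov2018, Thm. 6 (proof, §6 p.19)]
[cite: AroraBarakCC2009, §1.3] -/
theorem verifF_mem_FP : verifF ∈ FP :=
  andFn_mem_FP (comp_mem_FP KIReduction.validF_mem_FP fstF_mem_FP)
    (andFn_mem_FP (comp_mem_FP AKSMachine.aksFn_mem_FP pcF_mem_FP)
      (andFn_mem_FP (comp_mem_FP Brick.ltFn_mem_FP (fanoutFn_mem_FP vcF'_mem_FP pcF_mem_FP))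
        (andFn_mem_FP (comp_mem_FP ltLenF_mem_FP (fanoutFn_mem_FP bU_mem_FP pcF_mem_FP))
          (andFn_mem_FP lvl0F_mem_FP (andFn_mem_FP allLevelsF_mem_FP finalF_mem_FP)))))

/-! ### One-bit components -/

/-- `aksFn` is one-bit on every string. [cite: AgrawalKayalSaxena2004, Thm 4.1] -/
private theorem oneBit_aksFn : OneBit AKSMachine.aksFn := fun w => by
  by_cases h : w ∈ PRIMES
  · exact ⟨true, (aksFn_decides_PRIMES w).1 h⟩
  · exact ⟨false, (aksFn_decides_PRIMES w).2 h⟩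

/-- `fdegLeF` is one-bit. [folklore] -/
private theorem oneBit_fdegLeF : OneBit fdegLeF := fun w => by
  rcases fdegLeF_oneBit w with h | h
  · exact ⟨true, h⟩
  · exact ⟨false, h⟩

/-- `validF` is one-bit. [folklore] -/
private theorem oneBit_validF : OneBit KIReduction.validF := fun w => ⟨_, KIReduction.validF_apply w⟩

/-- `c1F` … `finalF` are one-bit. [folklore] -/
private theorem oneBit_components :
    OneBit c1F ∧ OneBit c2F ∧ OneBit c3F ∧ OneBit c4F ∧ OneBit lvl0F ∧ OneBit allLevelsF ∧ OneBit finalF :=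
  ⟨oneBit_validF.comp _, oneBit_aksFn.comp _, oneBit_ltFn.comp _, oneBit_ltLenF.comp _,
    oneBit_andFn (oneBit_fdegLeF.comp _) (oneBit_eqValFn.comp _), oneBit_eqValFn.comp _, oneBit_eqValFn.comp _⟩

/-- An `andFn` of one-bit conditions is `[true]` iff both are. [folklore] -/
private theorem andFn_eq_true_iff {c d : List Bool → List Bool} (hc : OneBit c) (hd : OneBit d) (s : List Bool) :
    andFn c d s = [true] ↔ c s = [true] ∧ d s = [true] := by
  obtain ⟨b, hb⟩ := hc s
  obtain ⟨b', hb'⟩ := hd s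
  rw [andFn_apply hb hb', hb, hb']
  cases b <;> cases b' <;> simp

/-- **The verifier is one-bit.** [cite: AroraBarakCC2009, §1.3] -/
theorem verifF_oneBit (s : List Bool) : verifF s = [true] ∨ verifF s = [false] := by
  obtain ⟨h1, h2, h3, h4, h5, h6, h7⟩ := oneBit_components
  obtain ⟨b, hb⟩ := (oneBit_andFn h1 (oneBit_andFn h2 (oneBit_andFn h3 (oneBit_andFn h4
    (oneBit_andFn h5 (oneBit_andFn h6 h7)))))) s
  rw [verifF, hb]
  cases b
  · exact Or.inr rfl
  · exact Or.inl rfl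

/-! ### Values on the structured input -/

section Spec

variable (z pb W y : List Bool)

/-- The parsed dimension. [folklore] -/
private def nn : ℕ := KIReduction.nOf (boolPair z (boolPair pb W))
/-- The guessed modulus. [folklore] -/
private def pp : ℕ := bitsToNat pb
/-- The coin blocks. [folklore] -/
private def TT : List Bool := y.take (nn z pb W * nn z pb W * bOf (nn z pb W))
/-- The context record of the structured input. [folklore] -/
private def ctx : List Bool :=
  boolPair (ones (nn z pb W)) (boolPair (ones (bOf (nn z pb W))) (boolPair (encodeNat (pp pb)) (boolPair (TT z pb W y) W)))

/-- Fields of `ctx`. [folklore] -/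
private theorem ctx_fields :
    nthF 0 (ctx z pb W y) = ones (nn z pb W) ∧ nthF 1 (ctx z pb W y) = ones (bOf (nn z pb W)) ∧
    nthF 2 (ctx z pb W y) = encodeNat (pp pb) ∧ nthF 3 (ctx z pb W y) = TT z pb W y ∧ sndPow 3 (ctx z pb W y) = W := by
  simp only [ctx, nthF_succ_boolPair, nthF_zero_boolPair, sndPow_succ_boolPair, sndPow_zero_boolPair, and_self]

/-- `ctxF` on the structured input is `ctx`. [folklore] -/
private theorem ctxF_eq : ctxF (boolPair (boolPair z (boolPair pb W)) y) = ctx z pb W y := by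
  have := ctxF_inp z pb W y
  rw [inp] at this
  rw [this]; rfl

/-- The word `i` of `W`. [folklore] -/
private def wd (i : ℕ) : List Bool := fstF (sndF^[i] W)

/-- **The evaluation of `w_i` at minor `j`** (the term inside the level sum). [folklore] -/
def minorEval (n b p : ℕ) (T W : List Bool) (i j : ℕ) : List Bool :=
  evalAtF (mkCtx (encodeNat p) (fstF (sndF^[i] W))
    (minorSegF (boolPair (ones (fstF (sndF^[i] W)).length) (boolPair (ones b) (boolPair T (boolPair (ones n) (ones j))))))
    (ones b))

/-- **The evaluation of `w_i` at the fitted random matrix.** [folklore] -/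
def fitEval (b p : ℕ) (T W : List Bool) (i : ℕ) : List Bool :=
  evalAtF (mkCtx (encodeNat p) (fstF (sndF^[i] W))
    (fitSegF (boolPair (ones (fstF (sndF^[i] W)).length) (boolPair (ones b) T))) (ones b))

/-- **The coefficient block `j`** of `T`. [folklore] -/
def coefBlock (b : ℕ) (T : List Bool) (j : ℕ) : List Bool := blockAtF (boolPair (boolPair (ones b) T) (ones j))

variable {z pb W y}

/-- Value of the accessors on the level record `⟨ctx, 1ⁱ⟩`. [folklore] -/
private theorem level_fields (i : ℕ) :
    lcn (boolPair (ctx z pb W y) (ones i)) = ones (nn z pb W) ∧ lcb (boolPair (ctx z pb W y) (ones i)) = ones (bOf (nn z pb W)) ∧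
    lcp (boolPair (ctx z pb W y) (ones i)) = encodeNat (pp pb) ∧ lcT (boolPair (ctx z pb W y) (ones i)) = TT z pb W y ∧
    lcW (boolPair (ctx z pb W y) (ones i)) = W ∧ liU (boolPair (ctx z pb W y) (ones i)) = ones i := by
  obtain ⟨h0, h1, h2, h3, h4⟩ := ctx_fields z pb W y
  simp only [lcn, lcb, lcp, lcT, lcW, liU, Function.comp_apply, fstF_boolPair, sndF_boolPair, h0, h1, h2, h3, h4,
    and_self]

/-- Value of `wNextF` on the level record: `w_{i+1}`. [folklore] -/
private theorem wNextF_level (i : ℕ) : wNextF (boolPair (ctx z pb W y) (ones i)) = wd W (i + 1) := by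
  obtain ⟨-, -, -, -, hW, hi⟩ := level_fields (z := z) (pb := pb) (W := W) (y := y) i
  rw [wNextF, Function.comp_apply, fanoutFn_apply, nthItemFn_boolPair, hW, Function.comp_apply, hi, wd,
    List.length_cons, KIReduction.length_ones']

/-- Value of `capF` on the level record: `bin (i+1)`. [folklore] -/
private theorem capF_level (i : ℕ) : capF (boolPair (ctx z pb W y) (ones i)) = encodeNat (i + 1) := by
  rw [capF, Function.comp_apply, Function.comp_apply, lenBinF_apply, liU, sndF_boolPair, List.length_cons,
    KIReduction.length_ones']

/-- Value of `lhsF` on the level record. [folklore] -/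
private theorem lhsF_level (i : ℕ) :
    lhsF (boolPair (ctx z pb W y) (ones i)) = fitEval (bOf (nn z pb W)) (pp pb) (TT z pb W y) W (i + 1) := by
  obtain ⟨-, hb, hp, hT, -, -⟩ := level_fields (z := z) (pb := pb) (W := W) (y := y) i
  rw [lhsF, evalWordF_apply, hp, hb, fanoutFn_apply, hb, hT, wNextF_level, fitEval, wd]

/-- Value of the inner accessors on `⟨⟨ctx, 1ⁱ⟩, 1ʲ⟩`. [folklore] -/
private theorem inner_fields (i j : ℕ) :
    ictx (boolPair (boolPair (ctx z pb W y) (ones i)) (ones j)) = ctx z pb W y ∧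
    iwCurF (boolPair (boolPair (ctx z pb W y) (ones i)) (ones j)) = wd W i := by
  obtain ⟨-, -, -, -, h4⟩ := ctx_fields z pb W y
  have hc : ictx (boolPair (boolPair (ctx z pb W y) (ones i)) (ones j)) = ctx z pb W y := by
    rw [ictx, Function.comp_apply, fstF_boolPair, fstF_boolPair]
  refine ⟨hc, ?_⟩
  simp only [iwCurF, Function.comp_apply, fanoutFn_apply, hc, h4, fstF_boolPair, sndF_boolPair, nthItemFn_boolPair,
    KIReduction.length_ones', wd]

/-- Value of `minorEvF` on the inner record. [folklore] -/
private theorem minorEvF_inner (i j : ℕ) :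
    minorEvF (boolPair (boolPair (ctx z pb W y) (ones i)) (ones j)) = minorEval (nn z pb W) (bOf (nn z pb W)) (pp pb) (TT z pb W y) W i j := by
  obtain ⟨hc, hw⟩ := inner_fields (z := z) (pb := pb) (W := W) (y := y) i j
  obtain ⟨h0, h1, h2, h3, -⟩ := ctx_fields z pb W y
  rw [minorEvF, evalWordF_apply, hw]
  simp only [Function.comp_apply, fanoutFn_apply, hc, sndF_boolPair, h0, h1, h2, h3]
  rfl

/-- Value of `coefF` on the inner record. [folklore] -/
private theorem coefF_inner (i j : ℕ) :
    coefF (boolPair (boolPair (ctx z pb W y) (ones i)) (ones j)) = coefBlock (bOf (nn z pb W)) (TT z pb W y) j := by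
  obtain ⟨hc, -⟩ := inner_fields (z := z) (pb := pb) (W := W) (y := y) i j
  obtain ⟨-, h1, -, h3, -⟩ := ctx_fields z pb W y
  simp only [coefF, Function.comp_apply, fanoutFn_apply, hc, sndF_boolPair, coefBlock, h1, h3]

/-- **Value of the level sum** (`2 ≤ p`, enough coins): on `⟨ctx, 1ⁱ⟩`,
`innerSumF = bin (Σ_{j<i+1} ⟦coefBlock j⟧ · ⟦minorEval i j⟧)`.
[cite: KabanetsImpagliazzo2003, Lemma 11 (2) (p. 358)] -/
theorem innerSumF_apply (hp : 2 ≤ pp pb) (hy : nn z pb W * nn z pb W * bOf (nn z pb W) ≤ y.length) (i : ℕ) :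
    innerSumF (boolPair (ctx z pb W y) (ones i)) =
      encodeNat (∑ j ∈ Finset.range (i + 1), bitsToNat (coefBlock (bOf (nn z pb W)) (TT z pb W y) j) *
        bitsToNat (minorEval (nn z pb W) (bOf (nn z pb W)) (pp pb) (TT z pb W y) W i j)) := by
  have hcnt : i + 1 ≤ X.eval (boolPair (ctx z pb W y) (ones i)).length := by
    rw [eval_X, length_boolPair, KIReduction.length_ones']; omega
  have hTlen : (TT z pb W y).length = nn z pb W * nn z pb W * bOf (nn z pb W) := by
    rw [TT, List.length_take]; exact min_eq_left hy
  -- the pieces are short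
  have hpiece : ∀ j, (innerPiece (boolPair (boolPair (ctx z pb W y) (ones i)) (ones j))).length ≤
      1 * ((boolPair (ctx z pb W y) (ones i)).length + 1) := by
    intro j
    rw [innerPiece, Function.comp_apply, fanoutFn_apply, prodFn_boolPair, coefF_inner, minorEvF_inner, one_mul]
    refine (Brick.length_encodeNat_mul_le _ _).trans ?_
    have h1 : (coefBlock (bOf (nn z pb W)) (TT z pb W y) j).length = bOf (nn z pb W) := by
      rw [coefBlock, length_blockAtF, KIReduction.length_ones']
    have h2 : (minorEval (nn z pb W) (bOf (nn z pb W)) (pp pb) (TT z pb W y) W i j).length ≤ (encodeNat (pp pb)).length := by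
      rw [minorEval]
      exact length_evalWord_le hp _ _ (by rw [(ptOf_minorSegF (m := nn z pb W * nn z pb W) hTlen).1])
    have h3 : bOf (nn z pb W) + (encodeNat (pp pb)).length ≤ (ctx z pb W y).length := by
      simp only [ctx, length_boolPair, KIReduction.length_ones']; omega
    rw [length_boolPair]; omega
  rw [innerSumF, Function.comp_apply, Function.comp_apply, fanoutFn_apply, fanoutFn_apply, fanoutFn_apply, id,
    capF_level, show (boolPair ([] : List Bool) []) = boolPair (ones 0) (encodeNat 0) by rfl, foldLoop_apply _ _ hcnt,
    foldAcc_clipF (fun j _ _ => hpiece j), foldAcc_addFn]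
  simp only [sndPow_succ_boolPair, sndPow_zero_boolPair, zero_add]
  apply congrArg encodeNat
  refine Finset.sum_congr rfl fun j _ => ?_
  rw [innerPiece, Function.comp_apply, fanoutFn_apply, prodFn_boolPair, bitsToNat_encodeNat, coefF_inner, minorEvF_inner]

/-- Value of `levelOKF` on the level record. [folklore] -/
private theorem levelOKF_eq_true_iff (i : ℕ) :
    levelOKF (boolPair (ctx z pb W y) (ones i)) = [true] ↔
      (rdCircuit (wd W (i + 1)).length (wd W (i + 1))).formalDegree ≤ i + 1 ∧
        bitsToNat (fitEval (bOf (nn z pb W)) (pp pb) (TT z pb W y) W (i + 1)) =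
          bitsToNat (rhsF (boolPair (ctx z pb W y) (ones i))) := by
  rw [levelOKF, andFn_eq_true_iff (show OneBit fdegNextF from oneBit_fdegLeF.comp _) (oneBit_eqValFn.comp _)]
  rw [fdegNextF, Function.comp_apply, fanoutFn_apply, wNextF_level, capF_level,
    fdegLeF_spec (wd W (i + 1)).length, bitsToNat_encodeNat, Function.comp_apply, fanoutFn_apply, eqValFn_boolPair,
    lhsF_level]
  simp

/-- Value of `rhsF` on the level record. [folklore] -/
private theorem rhsF_level (i : ℕ) :
    bitsToNat (rhsF (boolPair (ctx z pb W y) (ones i))) = bitsToNat (innerSumF (boolPair (ctx z pb W y) (ones i))) % pp pb := by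
  obtain ⟨-, -, hp, -, -, -⟩ := level_fields (z := z) (pb := pb) (W := W) (y := y) i
  rw [rhsF, Function.comp_apply, fanoutFn_apply, remFn_boolPair, bitsToNat_encodeNat, hp, bitsToNat_encodeNat]

/-- **Value of the failure count**: the number of levels `i < n` that do not pass.
[cite: KabanetsImpagliazzo2003, Lemma 11 (p. 358)] -/
private theorem levelsSumF_eq :
    levelsSumF (boolPair (boolPair z (boolPair pb W)) y) =
      encodeNat (∑ i ∈ Finset.range (nn z pb W), bitsToNat (levelFailF (boolPair (ctx z pb W y) (ones i)))) := by
  have hcnt : nn z pb W ≤ X.eval (ctx z pb W y).length := by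
    rw [eval_X]; simp only [ctx, length_boolPair, KIReduction.length_ones']; omega
  have hpiece : ∀ j, (levelFailF (boolPair (ctx z pb W y) (ones j))).length ≤ 1 * ((ctx z pb W y).length + 1) := by
    intro j
    obtain ⟨b, hb⟩ := (show OneBit levelFailF from
      oneBit_notFn (oneBit_andFn (show OneBit fdegNextF from oneBit_fdegLeF.comp _) (oneBit_eqValFn.comp _)))
      (boolPair (ctx z pb W y) (ones j))
    rw [hb]; simp
  rw [levelsSumF, Function.comp_apply, Function.comp_apply]
  simp only [fanoutFn_apply, Function.comp_apply, ctxF_eq, lenBinF_apply]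
  rw [show (nU (boolPair (boolPair z (boolPair pb W)) y)).length = nn z pb W by
    rw [show boolPair (boolPair z (boolPair pb W)) y = inp z pb W y from rfl, nU_inp, KIReduction.length_ones']; rfl]
  rw [show (boolPair ([] : List Bool) []) = boolPair (ones 0) (encodeNat 0) by rfl, foldLoop_apply _ _ hcnt,
    foldAcc_clipF (fun j _ _ => hpiece j), foldAcc_addFn]
  simp only [sndPow_succ_boolPair, sndPow_zero_boolPair, zero_add]

/-- **All levels pass iff every level passes.** [cite: KabanetsImpagliazzo2003, Lemma 11 (p. 358)] -/
private theorem allLevelsF_eq_true_iff :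
    allLevelsF (boolPair (boolPair z (boolPair pb W)) y) = [true] ↔
      ∀ i < nn z pb W, levelOKF (boolPair (ctx z pb W y) (ones i)) = [true] := by
  rw [allLevelsF, Function.comp_apply, fanoutFn_apply, eqValFn_boolPair, levelsSumF_eq, bitsToNat_encodeNat]
  simp only [bitsToNat_nil, List.cons.injEq, and_true, decide_eq_true_eq, Finset.sum_eq_zero_iff, Finset.mem_range]
  refine forall_congr' fun i => imp_congr_right fun _ => ?_
  obtain ⟨b, hb⟩ := (show OneBit levelOKF from
    oneBit_andFn (show OneBit fdegNextF from oneBit_fdegLeF.comp _) (oneBit_eqValFn.comp _)) (boolPair (ctx z pb W y) (ones i))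
  rw [levelFailF, notFn_apply hb, hb]
  cases b <;> simp [bitsToNat]

/-- Value of `lvl0F`. [folklore] -/
private theorem lvl0F_eq_true_iff :
    lvl0F (boolPair (boolPair z (boolPair pb W)) y) = [true] ↔
      (rdCircuit (wd W 0).length (wd W 0)).formalDegree ≤ 1 ∧
        bitsToNat (fitEval (bOf (nn z pb W)) (pp pb) (TT z pb W y) W 0) = 1 := by
  have hw0 : w0F (boolPair (boolPair z (boolPair pb W)) y) = wd W 0 := by simp [w0F, WF, wd]
  rw [lvl0F, andFn_eq_true_iff (oneBit_fdegLeF.comp _) (oneBit_eqValFn.comp _)]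
  rw [Function.comp_apply, fanoutFn_apply, hw0, fdegLeF_spec (wd W 0).length, Function.comp_apply, fanoutFn_apply,
    eqValFn_boolPair, ev0F, evalWordF_apply, hw0, fanoutFn_apply,
    show boolPair (boolPair z (boolPair pb W)) y = inp z pb W y from rfl, pcF_inp, bU_inp, TF_inp]
  simp only [List.cons.injEq, and_true, decide_eq_true_eq]
  simp [bitsToNat, fitEval, wd, nn, pp, TT]

/-- Value of `finalF`. [folklore] -/
private theorem finalF_eq_true_iff :
    finalF (boolPair (boolPair z (boolPair pb W)) y) = [true] ↔
      bitsToNat (evalAtF (mkCtx (encodeNat (pp pb)) (wd W (nn z pb W))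
        (entrySegF (boolPair (ones (wd W (nn z pb W)).length) (boolPair (ones (bOf (nn z pb W)))
          (boolPair (KIReduction.rowsStr (boolPair z (boolPair pb W))) (ones (nn z pb W))))))
        (ones (bOf (nn z pb W))))) = KIReduction.vOf (boolPair z (boolPair pb W)) := by
  have hwn : wnF (boolPair (boolPair z (boolPair pb W)) y) = wd W (nn z pb W) := by
    rw [wnF, Function.comp_apply, fanoutFn_apply, show boolPair (boolPair z (boolPair pb W)) y = inp z pb W y from rfl,
      nU_inp, WF_inp, nthItemFn_boolPair, KIReduction.length_ones', wd, nn]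
  rw [finalF, Function.comp_apply, fanoutFn_apply, eqValFn_boolPair, evFinF, evalWordF_apply, hwn, fanoutFn_apply,
    fanoutFn_apply, show boolPair (boolPair z (boolPair pb W)) y = inp z pb W y from rfl, pcF_inp, bU_inp, rowsF'_inp,
    nU_inp, vcF'_inp, KIReduction.vOf]
  simp only [List.cons.injEq, and_true, decide_eq_true_eq]
  rfl

/-- Values of the four deterministic checks. [folklore] -/
private theorem detChecks_iff :
    (c1F (boolPair (boolPair z (boolPair pb W)) y) = [true] ↔
        fstF (boolPair z (boolPair pb W)) = KIReduction.canonX (boolPair z (boolPair pb W))) ∧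
    (c2F (boolPair (boolPair z (boolPair pb W)) y) = [true] ↔ (pp pb).Prime) ∧
    (c3F (boolPair (boolPair z (boolPair pb W)) y) = [true] ↔ KIReduction.vOf (boolPair z (boolPair pb W)) < pp pb) ∧
    (c4F (boolPair (boolPair z (boolPair pb W)) y) = [true] ↔ 2 ^ bOf (nn z pb W) ≤ pp pb) := by
  refine ⟨?_, ?_, ?_, ?_⟩
  · rw [c1F, Function.comp_apply, fstF_boolPair, KIReduction.validF_apply]; simp
  · rw [c2F, Function.comp_apply, show boolPair (boolPair z (boolPair pb W)) y = inp z pb W y from rfl, pcF_inp,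
      AKSMachine.aksFn_encodeNat, pp]
    simp only [List.cons.injEq, and_true]
    exact Literature.NumberTheory.Primality.AKS.aksDecide_eq_true_iff _
  · rw [c3F, Function.comp_apply, fanoutFn_apply, ltFn_boolPair,
      show boolPair (boolPair z (boolPair pb W)) y = inp z pb W y from rfl, pcF_inp, vcF'_inp, bitsToNat_encodeNat,
      KIReduction.vOf, pp]
    simp
  · rw [c4F, Function.comp_apply, fanoutFn_apply, ltLenF_boolPair,
      show boolPair (boolPair z (boolPair pb W)) y = inp z pb W y from rfl, pcF_inp, bU_inp, KIReduction.length_ones',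
      TM2Pass.length_encodeNat_eq_size, pp]
    simp [Nat.lt_size, nn]

/-- **Structural specification of the verifier** on `s = ⟨⟨z, ⟨pb, W⟩⟩, y⟩` (`n = nOf`, `p = ⟦pb⟧`,
`b = n² + 2`, `T = y ↾ n²b`, `w_i = fstF (sndF^i W)`): it accepts iff the instance is canonical, `p` is
prime, `v < p`, `2^b ≤ p`, `formalDegree (rd w_0) ≤ 1`, `⟦w_0(R)⟧ = 1`, every level `i < n` has
`formalDegree (rd w_{i+1}) ≤ i + 1` and `⟦w_{i+1}(R)⟧ = (Σ_{j ≤ i} ⟦block j⟧·⟦w_i(minor_j R)⟧) mod p`, and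
`⟦w_n(A)⟧ = v` — evaluation terms left as `evalAtF` terms (`fitEval`, `minorEval`, the entry
evaluation), interpreted by `bitsToNat_evalWord` and the `PointSeg.ptOf_*` lemmas.
[cite: BlaserIkenmeyerJindalLysikov2018, Thm. 6 (proof, §6 p.19)] [cite: KabanetsImpagliazzo2003, Lemma 11 and proof of Cor. 12 (p. 358)] -/
theorem verifF_eq_true_iff (hy : KIReduction.nOf (boolPair z (boolPair pb W)) * KIReduction.nOf (boolPair z (boolPair pb W)) *
      bOf (KIReduction.nOf (boolPair z (boolPair pb W))) ≤ y.length) :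
    verifF (boolPair (boolPair z (boolPair pb W)) y) = [true] ↔
      fstF (boolPair z (boolPair pb W)) = KIReduction.canonX (boolPair z (boolPair pb W)) ∧
      (bitsToNat pb).Prime ∧
      KIReduction.vOf (boolPair z (boolPair pb W)) < bitsToNat pb ∧
      2 ^ bOf (KIReduction.nOf (boolPair z (boolPair pb W))) ≤ bitsToNat pb ∧
      ((rdCircuit (fstF W).length (fstF W)).formalDegree ≤ 1 ∧
        bitsToNat (fitEval (bOf (KIReduction.nOf (boolPair z (boolPair pb W)))) (bitsToNat pb)
          (y.take (KIReduction.nOf (boolPair z (boolPair pb W)) * KIReduction.nOf (boolPair z (boolPair pb W)) *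
            bOf (KIReduction.nOf (boolPair z (boolPair pb W))))) W 0) = 1) ∧
      (∀ i < KIReduction.nOf (boolPair z (boolPair pb W)),
        (rdCircuit (fstF (sndF^[i + 1] W)).length (fstF (sndF^[i + 1] W))).formalDegree ≤ i + 1 ∧
        bitsToNat (fitEval (bOf (KIReduction.nOf (boolPair z (boolPair pb W)))) (bitsToNat pb)
          (y.take (KIReduction.nOf (boolPair z (boolPair pb W)) * KIReduction.nOf (boolPair z (boolPair pb W)) *
            bOf (KIReduction.nOf (boolPair z (boolPair pb W))))) W (i + 1)) =
          (∑ j ∈ Finset.range (i + 1),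
            bitsToNat (coefBlock (bOf (KIReduction.nOf (boolPair z (boolPair pb W))))
              (y.take (KIReduction.nOf (boolPair z (boolPair pb W)) * KIReduction.nOf (boolPair z (boolPair pb W)) *
                bOf (KIReduction.nOf (boolPair z (boolPair pb W))))) j) *
            bitsToNat (minorEval (KIReduction.nOf (boolPair z (boolPair pb W))) (bOf (KIReduction.nOf (boolPair z (boolPair pb W))))
              (bitsToNat pb)
              (y.take (KIReduction.nOf (boolPair z (boolPair pb W)) * KIReduction.nOf (boolPair z (boolPair pb W)) *
                bOf (KIReduction.nOf (boolPair z (boolPair pb W))))) W i j)) % bitsToNat pb) ∧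
      bitsToNat (evalAtF (mkCtx (encodeNat (bitsToNat pb)) (fstF (sndF^[KIReduction.nOf (boolPair z (boolPair pb W))] W))
        (entrySegF (boolPair (ones (fstF (sndF^[KIReduction.nOf (boolPair z (boolPair pb W))] W)).length)
          (boolPair (ones (bOf (KIReduction.nOf (boolPair z (boolPair pb W)))))
            (boolPair (KIReduction.rowsStr (boolPair z (boolPair pb W))) (ones (KIReduction.nOf (boolPair z (boolPair pb W))))))))
        (ones (bOf (KIReduction.nOf (boolPair z (boolPair pb W))))))) = KIReduction.vOf (boolPair z (boolPair pb W)) := by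
  obtain ⟨h1, h2, h3, h4, h5, h6, h7⟩ := oneBit_components
  obtain ⟨e1, e2, e3, e4⟩ := detChecks_iff (z := z) (pb := pb) (W := W) (y := y)
  rw [verifF, andFn_eq_true_iff h1 (oneBit_andFn h2 (oneBit_andFn h3 (oneBit_andFn h4 (oneBit_andFn h5 (oneBit_andFn h6 h7))))),
    andFn_eq_true_iff h2 (oneBit_andFn h3 (oneBit_andFn h4 (oneBit_andFn h5 (oneBit_andFn h6 h7)))),
    andFn_eq_true_iff h3 (oneBit_andFn h4 (oneBit_andFn h5 (oneBit_andFn h6 h7))),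
    andFn_eq_true_iff h4 (oneBit_andFn h5 (oneBit_andFn h6 h7)), andFn_eq_true_iff h5 (oneBit_andFn h6 h7),
    andFn_eq_true_iff h6 h7, e1, e2, e3, e4, lvl0F_eq_true_iff, allLevelsF_eq_true_iff, finalF_eq_true_iff]
  -- only the levels need the value of the inner sum, which is available once `2 ≤ p`
  constructor
  · rintro ⟨hc1, hc2, hc3, hc4, hl0, hall, hfin⟩
    have hp : 2 ≤ pp pb := by
      have h2 : 2 ≤ 2 ^ bOf (nn z pb W) :=
        calc (2:ℕ) = 2 ^ 1 := by norm_num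
          _ ≤ 2 ^ bOf (nn z pb W) := Nat.pow_le_pow_right (by norm_num) (by rw [bOf]; omega)
      exact h2.trans hc4
    refine ⟨hc1, hc2, hc3, hc4, hl0, fun i hi => ?_, hfin⟩
    have h := (levelOKF_eq_true_iff i).1 (hall i hi)
    rw [rhsF_level, innerSumF_apply hp hy, bitsToNat_encodeNat] at h
    exact h
  · rintro ⟨hc1, hc2, hc3, hc4, hl0, hall, hfin⟩
    have hp : 2 ≤ pp pb := by
      have h2 : 2 ≤ 2 ^ bOf (nn z pb W) :=
        calc (2:ℕ) = 2 ^ 1 := by norm_num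
          _ ≤ 2 ^ bOf (nn z pb W) := Nat.pow_le_pow_right (by norm_num) (by rw [bOf]; omega)
      exact h2.trans hc4
    refine ⟨hc1, hc2, hc3, hc4, hl0, fun i hi => ?_, hfin⟩
    rw [levelOKF_eq_true_iff, rhsF_level, innerSumF_apply hp hy, bitsToNat_encodeNat]
    exact hall i hi

end Spec

end Thm6Verifier

end Literature.Barriers.ValiantsHypothesis

end
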